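import Literature.NumberTheory.LFunctions.ZetaLogDerivRePartialFraction
import Literature.Analysis.SpecialFunctions.DigammaGauss
import HarnessLib

/-!
# `Re ζ'/ζ(σ+it) = F(σ+it) − ½ log t + O(1)` (Balazard–de Roton 2008, Prop. 2)

Topic `Literature/NumberTheory/LFunctions`. This file DEFINES the zero-side sum
`F(s) = Σ_ρ m(ρ) Re 1/(s−ρ) = Σ_ρ m(ρ)(σ−β)/((σ−β)² + (t−γ)²)` of M. Balazard, A. de Roton,
arXiv:0810.3587, (eq. after Prop. 2) — the sum over the non-trivial zeros of `ζ` counted with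
multiplicity, absolutely convergent (`Literature.NumberTheory.LFunctions.summable_norm_zeroOrder_mul_re_inv_sub`) —
and PROVES their Prop. 2 with an explicit constant, for all `t ≥ 2` (no "T assez grand" needed):

> **Proposition 2.** `Re ζ'/ζ(σ+it) = F(s) − ½ log T + O(1)` (`1/2 ≤ σ ≤ 2`, `T ≤ t ≤ 2T`, `ζ(σ+it) ≠ 0`).

`Literature.NumberTheory.LFunctions.abs_re_logDeriv_zeta_sub_reZeroSideSum_le`:
`|Re ζ'/ζ(s) − (F(s) − ½ log(Im s))| ≤ 4` for `0 ≤ Re s ≤ 3`, `Im s ≥ 2`, `ζ(s) ≠ 0`.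
Proof (as printed: "(t53) et ψ(s) = log s + O(1/s)"): the tree's global de la Vallée Poussin formula
with multiplicities `Literature.NumberTheory.LFunctions.re_neg_logDeriv_zeta_hadamard`
(Davenport Ch. 12 (8)–(11)) and the vertical Stirling bound for `Re ψ`
(`Literature.Analysis.SpecialFunctions.Complex.abs_re_digamma_sub_log_norm_le`).

## References

* [BalazardDeRoton2008] M. Balazard, A. de Roton, arXiv:0810.3587, Prop. 2. [cite: BalazardDeRoton2008, Prop. 2]
* H. Davenport, *Multiplicative Number Theory*, 3rd ed., Ch. 12, (8)–(11).
-/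

noncomputable section

open Complex Real Filter Topology Set

namespace Literature.NumberTheory.LFunctions

/-- **Balazard–de Roton's `F(s) = Σ_ρ m(ρ) Re 1/(s−ρ)`**, the sum over the non-trivial zeros of `ζ`
with multiplicity (absolutely convergent when `ζ(s) ≠ 0`; `Re 1/(s−ρ) = (σ−β)/((σ−β)²+(t−γ)²)`).
[cite: BalazardDeRoton2008, Prop. 2] -/
def reZeroSideSum (s : ℂ) : ℝ :=
  ∑' ρ : RHWave0.riemannZetaNontrivialZeros, (riemannZetaZeroOrder (ρ : ℂ) : ℝ) * (1 / (s - ρ)).re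

/-- Unfolding `reZeroSideSum`. [folklore] -/
theorem reZeroSideSum_def (s : ℂ) :
    reZeroSideSum s =
      ∑' ρ : RHWave0.riemannZetaNontrivialZeros, (riemannZetaZeroOrder (ρ : ℂ) : ℝ) * (1 / (s - ρ)).re := rfl

/-- **Balazard–de Roton 2008, Prop. 2** (explicit form): for `0 ≤ Re s ≤ 3`, `Im s ≥ 2` and
`ζ(s) ≠ 0`, `|Re ζ'/ζ(s) − (F(s) − ½ log(Im s))| ≤ 4`. [cite: BalazardDeRoton2008, Prop. 2] -/
theorem abs_re_logDeriv_zeta_sub_reZeroSideSum_le {s : ℂ} (hσ0 : 0 ≤ s.re) (hσ3 : s.re ≤ 3)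
    (ht : 2 ≤ s.im) (hζ : riemannZeta s ≠ 0) :
    |(deriv riemannZeta s / riemannZeta s).re - (reZeroSideSum s - Real.log s.im / 2)| ≤ 4 := by
  have h0 : s ≠ 0 := fun h ↦ by rw [h] at ht; simp at ht; linarith
  have h1 : s ≠ 1 := fun h ↦ by rw [h] at ht; simp at ht; linarith
  have hhad := re_neg_logDeriv_zeta_hadamard (by linarith) h0 h1 hζ
  rw [← reZeroSideSum_def] at hhad
  -- the digamma term: `w = s/2 + 1`
  set w : ℂ := s / 2 + 1 with hw
  have hwre : w.re = s.re / 2 + 1 := by simp [hw]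
  have hwim : w.im = s.im / 2 := by simp [hw]
  have hwre0 : 0 < w.re := by rw [hwre]; linarith
  have hwim0 : w.im ≠ 0 := by rw [hwim]; linarith
  have hwim1 : 1 ≤ |w.im| := by rw [hwim, abs_of_pos (by linarith)]; linarith
  have hdig := Literature.Analysis.SpecialFunctions.Complex.abs_re_digamma_sub_log_norm_le hwre0 hwim0
  -- `‖w‖ ≥ |Im w| ≥ 1` and `log ‖w‖ − log(t/2) ∈ [0, 1]`
  have hnorm_ge : s.im / 2 ≤ ‖w‖ := by
    have := Complex.abs_im_le_norm w
    rw [hwim, abs_of_pos (by linarith)] at this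
    exact this
  have hnorm1 : 1 ≤ ‖w‖ := by linarith
  have hnormsq : ‖w‖ ^ 2 = (s.re / 2 + 1) ^ 2 + (s.im / 2) ^ 2 := by
    rw [Complex.sq_norm, Complex.normSq_apply, hwre, hwim]; ring
  have hlog_lo : Real.log (s.im / 2) ≤ Real.log ‖w‖ := Real.log_le_log (by linarith) hnorm_ge
  have hlog_hi : Real.log ‖w‖ ≤ Real.log (s.im / 2) + 1 := by
    -- `‖w‖² = (σ/2+1)² + (t/2)² ≤ e² (t/2)²`
    have h7 : (7.3 : ℝ) ≤ Real.exp 2 := by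
      have h2 : Real.exp 2 = Real.exp 1 * Real.exp 1 := by rw [← Real.exp_add]; norm_num
      rw [h2]; nlinarith [Real.exp_one_gt_d9, Real.exp_pos 1]
    have hsq : ‖w‖ ^ 2 ≤ (Real.exp 1 * (s.im / 2)) ^ 2 := by
      have h2 : (Real.exp 1 * (s.im / 2)) ^ 2 = Real.exp 2 * (s.im / 2) ^ 2 := by
        rw [mul_pow, ← Real.exp_nat_mul]; norm_num
      rw [hnormsq, h2]
      nlinarith [h7, hσ0, hσ3, ht]
    have hle : ‖w‖ ≤ Real.exp 1 * (s.im / 2) :=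
      (pow_le_pow_iff_left₀ (norm_nonneg w) (by positivity) two_ne_zero).1 hsq
    calc Real.log ‖w‖ ≤ Real.log (Real.exp 1 * (s.im / 2)) := Real.log_le_log (by linarith) hle
      _ = Real.log (s.im / 2) + 1 := by
          rw [Real.log_mul (Real.exp_pos 1).ne' (by linarith), Real.log_exp]; ring
  -- the small terms
  have hre1 : |(1 / (s - 1)).re| ≤ 1 / 2 := by
    have h := Complex.abs_re_le_norm (1 / (s - 1))
    have him : 2 ≤ ‖s - 1‖ := by
      have := Complex.abs_im_le_norm (s - 1)
      rw [Complex.sub_im, Complex.one_im, sub_zero, abs_of_pos (by linarith)] at this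
      linarith
    have hn : ‖1 / (s - 1)‖ ≤ 1 / 2 := by
      rw [norm_div, norm_one]
      exact one_div_le_one_div_of_le (by norm_num) him
    exact h.trans hn
  have hlogπ0 : 0 ≤ Real.log π := Real.log_nonneg (by linarith [Real.pi_gt_three])
  have hlogπ1 : Real.log π ≤ 2.2 := by
    have := Real.log_le_sub_one_of_pos Real.pi_pos; linarith [Real.pi_lt_d2]
  have hlog20 : 0 ≤ Real.log 2 := Real.log_nonneg (by norm_num)
  have hlog21 : Real.log 2 ≤ 0.7 := by have := Real.log_two_lt_d9; linarith
  have hdig' : |(digamma w).re - Real.log ‖w‖| ≤ 1.3 := by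
    refine hdig.trans ?_
    have h1 : 1 / (2 * ‖w‖ ^ 2) ≤ 1 / 2 := by
      rw [div_le_div_iff₀ (by positivity) (by norm_num)]; nlinarith [hnorm1]
    have h2 : π / (4 * |w.im|) ≤ π / 4 := by
      refine div_le_div_of_nonneg_left Real.pi_pos.le (by norm_num) ?_; linarith [hwim1]
    linarith [h1, h2, Real.pi_lt_d2]
  -- the identity
  have e1 : Real.log (s.im / 2) = Real.log s.im - Real.log 2 := Real.log_div (by linarith) (by norm_num)
  rw [Complex.neg_re] at hhad
  have hid : (deriv riemannZeta s / riemannZeta s).re - (reZeroSideSum s - Real.log s.im / 2) =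
      -(1 / (s - 1)).re + Real.log π / 2 - ((digamma w).re - Real.log ‖w‖) / 2 -
        (Real.log ‖w‖ - Real.log (s.im / 2)) / 2 + Real.log 2 / 2 := by
    linear_combination -hhad - (1 / 2 : ℝ) * e1
  rw [hid]
  obtain ⟨ha1, ha2⟩ := abs_le.1 hre1
  obtain ⟨hd1, hd2⟩ := abs_le.1 hdig'
  rw [abs_le]
  constructor <;> linarith

end Literature.NumberTheory.LFunctions
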